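import Literature.MathematicalPhysics.QuantumFieldTheory.QuasiLocalGaugePerturbationDecouplingVolumes
import HarnessLib

/-!
# Quasi-local gauge-invariant perturbations, VII-d: the hyper-Markov property of the joint kernels

Companion ("theorems only") file of `QuasiLocalGaugePerturbationDecoupling.lean` /
`…DecouplingVolumes.lean`. The joint `(U, mark)` kernel of a joint volume — the links of `ΛE` and
the marks of a set `ΛP` of far polymers all of whose links lie in `ΛE` (saturation) — does not
see the exterior beyond the links whose block is `1`-near the blocks of `ΛE`, nor any exterior
mark, PROVIDED every exterior mark of a far polymer with a link in `ΛE` is inactive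
(`integral_jointSpec_eq_of_exterior`): an inactive polymer is absent from the interaction exactly,
and an active exterior polymer avoiding `ΛE` contributes a constant to the glued energy. This is
the Markov structure of the two-species (hyperedge-defect) Dobrushin–Shlosman engine: exact
locality on the event that no active hyperedge crosses the boundary of the resampled volume.

## References

* H.-O. Georgii, *Gibbs Measures and Phase Transitions* (2011), Def. 1.23, (2.11), Ch. 8.
* S. Friedli, Y. Velenik, *Statistical Mechanics of Lattice Systems* (CUP 2017), §6.3.2
  eq. (6.10) (locality of energy differences).
-/

noncomputable section

open MeasureTheory Finset
open scoped ENNReal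
open Literature.Probability.LatticeModels (glueWith glueWith_apply_mem glueWith_apply_not_mem
  measurable_glueWith Specification IsSpecification integral_glued_tilted_eq_hetero)
open Literature.MathematicalPhysics.QuantumLattice

namespace Literature.MathematicalPhysics.QuantumFieldTheory

namespace QuasiLocalGaugePerturbation

variable {d N : ℕ} [NeZero N] {G : Type*} [Group G] [MeasurableSpace G] {b : ℕ}
  (W : QuasiLocalGaugePerturbation d N G b)

/-- The difference of the near totals of two link exteriors agreeing on the links whose block is
`1`-near `R ⊇` the blocks of `Λ` does not depend on the glued link variables. [folklore] -/
theorem near_total_glueWith_sub_eq {R : Finset (Site d N)} {Λ : Finset (Edge d N)}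
    (hΛ : ∀ e ∈ Λ, blockCorner b e.1 ∈ R) {ζ ζ' : GaugeConfig d N G}
    (hζ : ∀ e : Edge d N, (∃ y ∈ R, ∀ i, (y i - blockCorner b e.1 i).val ≤ b * 1 ∨
      (blockCorner b e.1 i - y i).val ≤ b * 1) → ζ e = ζ' e) (u u₀ : Λ → G) :
    (W.restrict fun X => X.card = 1).total (glueWith Λ u ζ) -
        (W.restrict fun X => X.card = 1).total (glueWith Λ u ζ') =
      (W.restrict fun X => X.card = 1).total (glueWith Λ u₀ ζ) -
        (W.restrict fun X => X.card = 1).total (glueWith Λ u₀ ζ') := by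
  simp only [total, ← Finset.sum_sub_distrib]
  refine Finset.sum_congr rfl fun X _ => ?_
  by_cases hX : X.card = 1
  · simp only [restrict_act, hX, if_true]
    refine sub_apply_glueWith_eq_of_short hΛ hζ (M := 1) (fun y hy y' hy' i => ?_) (W.dependsOn X) u u₀
    obtain ⟨z, hz⟩ := Finset.card_eq_one.1 hX
    rw [hz, Finset.mem_singleton] at hy hy'
    subst hy; subst hy'
    left; simp
  · simp only [restrict_act, hX, if_false, sub_self]


section Markov

variable [TopologicalSpace G] [IsTopologicalGroup G] [CompactSpace G] [BorelSpace G]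
  {Nρ : ℕ} (ρ : G →* Matrix (Fin Nρ) (Fin Nρ) ℂ) (hρ : Continuous ρ) [SecondCountableTopology G]

include hρ in
/-- Hyper-Markov property of the joint kernels, auxiliary form in which the two boundary
conditions are asked to agree on ALL link sites whose block is `1`-near `R` (including the
resampled ones, whose exterior values are immaterial); see `integral_jointSpec_eq_of_exterior`.
[folklore] -/
theorem integral_jointSpec_eq_of_exterior' (hb : 0 < b) (β : ℝ) (ΛE : Finset (Edge d N))
    (ΛP : Finset (FarPoly b d N)) {R : Finset (Site d N)} (hΛ : ∀ e ∈ ΛE, blockCorner b e.1 ∈ R)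
    (hsat : ∀ X ∈ ΛP, polymerEdges b X.1 ⊆ ΛE) {ξ ξ' : JSite b d N → G × Bool}
    (hagree : ∀ e : Edge d N, (∃ y ∈ R, ∀ i, (y i - blockCorner b e.1 i).val ≤ b * 1 ∨
      (blockCorner b e.1 i - y i).val ≤ b * 1) → ξ (Sum.inl e) = ξ' (Sum.inl e))
    (hNC : ∀ X : FarPoly b d N, X ∉ ΛP → (∃ e ∈ ΛE, e ∈ polymerEdges b X.1) →
      markOf ξ X = false ∧ markOf ξ' X = false)
    {f : (JSite b d N → G × Bool) → ℝ} (hf : Measurable f) (hf01 : ∀ σ, 0 ≤ f σ ∧ f σ ≤ 1)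
    (hdep : DependsOn f {v | v ∈ ΛE.map (linksEmb b d N) ∪ ΛP.map (marksEmb b d N) ∨ ξ v = ξ' v}) :
    ∫ σ, f σ ∂(W.jointSpec ρ β (ΛE.map (linksEmb b d N) ∪ ΛP.map (marksEmb b d N)) ξ) =
      ∫ σ, f σ ∂(W.jointSpec ρ β (ΛE.map (linksEmb b d N) ∪ ΛP.map (marksEmb b d N)) ξ') := by
  set Λ := ΛE.map (linksEmb b d N) ∪ ΛP.map (marksEmb b d N) with hΛdef
  have hφm := W.measurable_jointEnergy ρ hρ (b := b) β
  have hφb := W.exists_abs_jointEnergy_le ρ hρ (b := b) β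
  -- agreement of the link exteriors near `R`
  have hζ : ∀ e : Edge d N, (∃ y ∈ R, ∀ i, (y i - blockCorner b e.1 i).val ≤ b * 1 ∨
      (blockCorner b e.1 i - y i).val ≤ b * 1) → uOf ξ e = uOf ξ' e := fun e he => by
    simp only [uOf]; rw [hagree e he]
  let u₀ : ↥Λ → G × Bool := fun _ => ((1 : G), false)
  refine integral_glued_tilted_eq_hetero W.jointRef Λ ξ ξ' hφm hφm hφb hφb hf hf01 ?_
    (c := W.jointEnergy ρ β (glueWith Λ u₀ ξ) - W.jointEnergy ρ β (glueWith Λ u₀ ξ')) ?_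
  · -- the observable does not distinguish the two gluings
    intro u
    refine hdep fun v hv => ?_
    by_cases hvΛ : v ∈ Λ
    · rw [glueWith_apply_mem _ _ _ hvΛ, glueWith_apply_mem _ _ _ hvΛ]
    · rw [glueWith_apply_not_mem _ _ _ hvΛ, glueWith_apply_not_mem _ _ _ hvΛ]
      exact hv.resolve_left hvΛ
  · -- the energy difference does not depend on the glued variables
    intro u
    rw [jointEnergy_eq, jointEnergy_eq, jointEnergy_eq, jointEnergy_eq]
    rw [uOf_glueWith_union ΛE ΛP u ξ, uOf_glueWith_union ΛE ΛP u ξ',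
      uOf_glueWith_union ΛE ΛP u₀ ξ, uOf_glueWith_union ΛE ΛP u₀ ξ']
    have hW := wilsonAction_glueWith_sub_eq ρ hb hΛ (M := 1) le_rfl hζ (linkPart ΛE ΛP u)
      (linkPart ΛE ΛP u₀)
    have hN := W.near_total_glueWith_sub_eq hΛ hζ (linkPart ΛE ΛP u) (linkPart ΛE ΛP u₀)
    -- the mark terms, site by site
    have hM : ∀ v : JSite b d N,
        W.siteTerm (glueWith ΛE (linkPart ΛE ΛP u) (uOf ξ)) v (glueWith Λ u ξ v) -
          W.siteTerm (glueWith ΛE (linkPart ΛE ΛP u) (uOf ξ')) v (glueWith Λ u ξ' v) =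
        W.siteTerm (glueWith ΛE (linkPart ΛE ΛP u₀) (uOf ξ)) v (glueWith Λ u₀ ξ v) -
          W.siteTerm (glueWith ΛE (linkPart ΛE ΛP u₀) (uOf ξ')) v (glueWith Λ u₀ ξ' v) := by
      intro v
      rcases v with e | X
      · simp [siteTerm]
      · -- the activity of `X` reads only the links of `X`
        have hact : ∀ (w : ↥Λ → G × Bool) (ζ : GaugeConfig d N G),
            polymerEdges b X.1 ⊆ ΛE →
            W.act X.1 (glueWith ΛE (linkPart ΛE ΛP w) ζ) =
              W.act X.1 (glueWith ΛE (linkPart ΛE ΛP w) ζ) := fun _ _ _ => rfl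
        by_cases hX : X ∈ ΛP
        · -- resampled mark: same glued value, activity reads resampled links only
          have hv : Sum.inr X ∈ Λ := inr_mem_union_iff.2 hX
          rw [glueWith_apply_mem _ _ _ hv, glueWith_apply_mem _ _ _ hv,
            glueWith_apply_mem _ _ _ hv, glueWith_apply_mem _ _ _ hv]
          have hin : ∀ (w : ↥Λ → G × Bool),
              W.act X.1 (glueWith ΛE (linkPart ΛE ΛP w) (uOf ξ)) =
                W.act X.1 (glueWith ΛE (linkPart ΛE ΛP w) (uOf ξ')) := fun w =>
            W.dependsOn X.1 fun e he => by
              have heΛ : e ∈ ΛE := hsat X hX (Finset.mem_coe.1 he)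
              rw [glueWith_apply_mem _ _ _ heΛ, glueWith_apply_mem _ _ _ heΛ]
          simp only [siteTerm, Sum.elim_inr, hTilt, hin]
          ring
        · have hv : Sum.inr X ∉ Λ := fun h => hX (inr_mem_union_iff.1 h)
          rw [glueWith_apply_not_mem _ _ _ hv, glueWith_apply_not_mem _ _ _ hv,
            glueWith_apply_not_mem _ _ _ hv, glueWith_apply_not_mem _ _ _ hv]
          by_cases htouch : ∃ e ∈ ΛE, e ∈ polymerEdges b X.1
          · -- a crossing exterior polymer is inactive in both boundary conditions
            obtain ⟨h1, h2⟩ := hNC X hX htouch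
            simp only [markOf] at h1 h2
            simp [siteTerm, h1, h2]
          · -- an exterior polymer avoiding `ΛE` does not see the glued links
            push Not at htouch
            have hout : ∀ (w w' : ↥Λ → G × Bool) (ζ : GaugeConfig d N G),
                W.act X.1 (glueWith ΛE (linkPart ΛE ΛP w) ζ) =
                  W.act X.1 (glueWith ΛE (linkPart ΛE ΛP w') ζ) := fun w w' ζ =>
              W.dependsOn X.1 fun e he => by
                have heΛ : e ∉ ΛE := fun h => htouch e h (Finset.mem_coe.1 he)
                rw [glueWith_apply_not_mem _ _ _ heΛ, glueWith_apply_not_mem _ _ _ heΛ]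
            simp only [siteTerm, Sum.elim_inr, hTilt, hout u u₀]
    have hMsum : ∑ v : JSite b d N,
        (W.siteTerm (glueWith ΛE (linkPart ΛE ΛP u) (uOf ξ)) v (glueWith Λ u ξ v) -
          W.siteTerm (glueWith ΛE (linkPart ΛE ΛP u) (uOf ξ')) v (glueWith Λ u ξ' v)) =
        ∑ v : JSite b d N,
        (W.siteTerm (glueWith ΛE (linkPart ΛE ΛP u₀) (uOf ξ)) v (glueWith Λ u₀ ξ v) -
          W.siteTerm (glueWith ΛE (linkPart ΛE ΛP u₀) (uOf ξ')) v (glueWith Λ u₀ ξ' v)) :=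
      Finset.sum_congr rfl fun v _ => hM v
    rw [Finset.sum_sub_distrib, Finset.sum_sub_distrib] at hMsum
    linear_combination (-β) * hW - hN + hMsum



omit [SecondCountableTopology G] in
/-- The joint kernel of a volume does not depend on the values of the boundary condition inside the
volume. [folklore] -/
theorem jointSpec_eq_of_eqOn_compl (β : ℝ) (Λ : Finset (JSite b d N)) {ξ ξ' : JSite b d N → G × Bool}
    (h : ∀ v, v ∉ Λ → ξ v = ξ' v) : W.jointSpec ρ β Λ ξ = W.jointSpec ρ β Λ ξ' := by
  simp only [jointSpec]
  have hglue : (fun u : ↥Λ → G × Bool => glueWith Λ u ξ) = fun u => glueWith Λ u ξ' := by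
    funext u; funext v
    by_cases hv : v ∈ Λ
    · rw [glueWith_apply_mem _ _ _ hv, glueWith_apply_mem _ _ _ hv]
    · rw [glueWith_apply_not_mem _ _ _ hv, glueWith_apply_not_mem _ _ _ hv, h v hv]
  rw [hglue]

include hρ in
/-- **Hyper-Markov property of the joint kernels.** Resample the links of `ΛE` and the marks of
`ΛP`, where every far polymer of `ΛP` has all its links in `ΛE` (saturation). Two boundary
conditions give the same kernel expectation to every `[0,1]`-valued observable reading only the
resampled sites and agreeing sites, provided (i) they agree, as joint values, on the EXTERIOR links
whose block is `1`-near `R ⊇` the blocks of `ΛE` (`b ≥ 1`), and (ii) every exterior mark of a far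
polymer with a link in `ΛE` is INACTIVE in both: the joint kernel does not see far links, nor any
exterior mark (an inactive polymer is absent from the interaction; an active exterior polymer
avoiding `ΛE` contributes a constant). [folklore] -/
theorem integral_jointSpec_eq_of_exterior (hb : 0 < b) (β : ℝ) (ΛE : Finset (Edge d N))
    (ΛP : Finset (FarPoly b d N)) {R : Finset (Site d N)} (hΛ : ∀ e ∈ ΛE, blockCorner b e.1 ∈ R)
    (hsat : ∀ X ∈ ΛP, polymerEdges b X.1 ⊆ ΛE) {ξ ξ' : JSite b d N → G × Bool}
    (hagree : ∀ e : Edge d N, e ∉ ΛE → (∃ y ∈ R, ∀ i, (y i - blockCorner b e.1 i).val ≤ b * 1 ∨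
      (blockCorner b e.1 i - y i).val ≤ b * 1) → ξ (Sum.inl e) = ξ' (Sum.inl e))
    (hNC : ∀ X : FarPoly b d N, X ∉ ΛP → (∃ e ∈ ΛE, e ∈ polymerEdges b X.1) →
      markOf ξ X = false ∧ markOf ξ' X = false)
    {f : (JSite b d N → G × Bool) → ℝ} (hf : Measurable f) (hf01 : ∀ σ, 0 ≤ f σ ∧ f σ ≤ 1)
    (hdep : DependsOn f {v | v ∈ ΛE.map (linksEmb b d N) ∪ ΛP.map (marksEmb b d N) ∨ ξ v = ξ' v}) :
    ∫ σ, f σ ∂(W.jointSpec ρ β (ΛE.map (linksEmb b d N) ∪ ΛP.map (marksEmb b d N)) ξ) =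
      ∫ σ, f σ ∂(W.jointSpec ρ β (ΛE.map (linksEmb b d N) ∪ ΛP.map (marksEmb b d N)) ξ') := by
  classical
  -- modify `ξ'` on the resampled link sites to agree with `ξ` there (the kernel does not see this)
  let ξ'' : JSite b d N → G × Bool := fun v => if v ∈ ΛE.map (linksEmb b d N) then ξ v else ξ' v
  have hin : ∀ v, v ∈ ΛE.map (linksEmb b d N) → ξ'' v = ξ v := fun v hv => if_pos hv
  have hout : ∀ v, v ∉ ΛE.map (linksEmb b d N) → ξ'' v = ξ' v := fun v hv => if_neg hv
  have hker : W.jointSpec ρ β (ΛE.map (linksEmb b d N) ∪ ΛP.map (marksEmb b d N)) ξ' =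
      W.jointSpec ρ β (ΛE.map (linksEmb b d N) ∪ ΛP.map (marksEmb b d N)) ξ'' :=
    W.jointSpec_eq_of_eqOn_compl ρ β _ fun v hv => (hout v fun h => hv (Finset.mem_union_left _ h)).symm
  rw [hker]
  refine W.integral_jointSpec_eq_of_exterior' ρ hρ hb β ΛE ΛP hΛ hsat (ξ := ξ) (ξ' := ξ'')
    (fun e he => ?_) (fun X hX htouch => ?_) hf hf01 (fun σ τ hστ => hdep fun v hv => hστ v ?_)
  · by_cases heΛ : e ∈ ΛE
    · exact (hin _ (Finset.mem_map_of_mem _ heΛ)).symm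
    · rw [hout _ fun h => heΛ ?_]
      · exact hagree e heΛ he
      · obtain ⟨e', he', hee⟩ := Finset.mem_map.1 h
        simp only [linksEmb_apply, Sum.inl.injEq] at hee
        exact hee ▸ he'
  · have hv : Sum.inr X ∉ ΛE.map (linksEmb b d N) := fun h => by
      obtain ⟨e, -, he⟩ := Finset.mem_map.1 h; simp at he
    refine ⟨(hNC X hX htouch).1, ?_⟩
    simp only [markOf, hout _ hv]
    exact (hNC X hX htouch).2
  · rcases hv with hv | hv
    · exact Or.inl hv
    · by_cases hvE : v ∈ ΛE.map (linksEmb b d N)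
      · exact Or.inl (Finset.mem_union_left _ hvE)
      · exact Or.inr (by rw [hout v hvE]; exact hv)

end Markov

end QuasiLocalGaugePerturbation

end Literature.MathematicalPhysics.QuantumFieldTheory

end
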